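import Summits.BirchSwinnertonDyer.BirchSwinnertonDyer.Theses.SemiOrdinaryEisensteinDescent
import Summits.BirchSwinnertonDyer.BirchSwinnertonDyer.Theorems.SchneiderFreeAdditiveX3JointUpperManin
import HarnessLib

/-!
# Crux Ko `WildKolyvaginUpperAtThree` (stmt-BirchSwinnertonDyer-20480) is EXACTLY the joint Euler-system half
# of BSD₃ over the pair `(E, E^{d_K})`: the converse bookkeeping (cell `bsd-wall`, width seat
# `bsd-wall-soed-p2-w3` gen 0; `--supports stmt-BirchSwinnertonDyer-20480`)

The tree has (door-c5 gen 8, p≈`SchneiderFreeAdditiveX3JointUpperManin`) `Upper.jointUpperBoundAt_of_coStepL_manin`: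
Ko's socket `Upper.IndexUpperBoundLeAt W p K P (v_p c)` on a Heegner frame ⟹ `Upper.JointUpperBoundAt W Wd p`
(`ord_p #Ш(E) + ord_p #Ш(E^{d_K}) ≤ ord_p #Ш_an(E) + ord_p #Ш_an(E^{d_K})`). THIS file proves the CONVERSE with
the same binders, so that on every frame

  Ko's socket at slack `v_p(c)`  ⟺  the JOINT upper (Euler-system) half of `BSD_p` over `(E, E^{d_K})`

modulo the named print {Gross–Zagier I.(6.3), Kolyvagin Thm. A, GZK, modularity, Gross–Zagier I.(7.3)}: the
Gross–Zagier bookkeeping identity `SchneiderFree.exists_shaAn_padicVal_eq_of_heegner_manin` is an EQUALITY, and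
the two twist transports are equalities (`X2.padicValNat_tamagawaProduct_twist_of_heegner_of_odd`,
`AdditivePotMult.padicValRat_u_eq_zero_of_twist_minimal_of_split`, the latter needs `p ∣ N`).

* §1 `indexUpperBoundLeAt_of_jointUpperBoundAt_manin` (generic odd `p ∣ N`, `r_an = 1`, odd `d_K`,
  `p ∤ #𝓞_K^×`): `JointUpperBoundAt W Wd p ⟹ IndexUpperBoundLeAt W p K P (v_p c)`.
* §2 `indexUpperBoundLeAt_of_missingUpper_of_missingUpper`: the two SEPARATE Euler-system halves
  `MissingUpperBoundAt W p` (`ord_p #Ш(E) ≤ ord_p #Ш_an(E)`) and `MissingUpperBoundAt Wd p` give the socket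
  (`jointUpper_of_upper_of_upper` + §1); in particular `BSDp W p ∧ BSDp Wd p ⟹` the socket
  (`indexUpperBoundLeAt_of_bsdp_of_bsdp`).
* §3 `wildKolyvaginUpperAtThree_frame_of_bsdp_of_bsdp`: under crux Ko's VERBATIM binders, `BSD₃(E)` and
  `BSD₃` of a minimal model of `E^{d_K}` (plus the five named facts) give Ko's conclusion on that frame.

WHY (method census `Cruxes/WildKolyvaginUpperAtThree/NOGO-STRINGENT-SCALING-w3.md`, this seat): beyond the
max-form (print-closed on single-carrier frames, `SemiOrdinaryEisensteinDescentWildKolyvaginUpperAtThreeSingleCarrier`,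
p579505) Ko has no line; on the residue (≥ 2 carriers) the only visible road to Ko is a posteriori, through the
row itself. §§1–3 make that precise: Ko there is neither weaker nor stronger than «the Euler-system half of
BSD₃ for E AND for E^{d_K}» — it is not an independent waypoint. CONDITIONAL on the named facts (hypotheses);
per frame; closes nothing; BSD is not proved for any curve by this file. No definition, no named fact, no `sorry`.

References: [GrossZagier1986] Thm. I.(6.3), (7.3); [Miller2011LMS] Def. 1.1; [JetchevSkinnerWan2017] §7.4.1
(arXiv:1512.06894 p. 30); [Gross1991] (2.4).
-/

noncomputable section

open scoped Classical

set_option linter.dupNamespace false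
set_option autoImplicit false

namespace Summit.BirchSwinnertonDyer.BirchSwinnertonDyer.Theorems.WildKolyvaginUpperAtThreeOfJointUpper

open WeierstrassCurve NumberField
  Literature.NumberTheory.EllipticCurves
  Literature.NumberTheory.EllipticCurves.ModularForms
  Literature.NumberTheory.EllipticCurves.Rank1Residual
  Literature.NumberTheory.EllipticCurves.Rank1Residual.Typed
  Summit.BirchSwinnertonDyer.Rank1Residual
  Summit.BirchSwinnertonDyer.Rank1Residual.Additive
  Summit.BirchSwinnertonDyer.Rank1Residual.X11b
  Summit.BirchSwinnertonDyer.BirchSwinnertonDyer.Theorems.SchneiderFree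
  Summit.BirchSwinnertonDyer.BirchSwinnertonDyer.Theorems.SchneiderFree.Upper

/-! ### §1 The joint upper half ⟹ co-STEP L at slack `v_p(c)` (converse of `jointUpperBoundAt_of_coStepL_manin`) -/

/-- **JOINT upper half over `(E, E^{d_K})` ⟹ Ko's socket at slack `v_p(c)`** — the converse of door-c5's
`Upper.jointUpperBoundAt_of_coStepL_manin`, same binders: odd `p ∣ N`, `r_an(E) = 1`, `K` imaginary quadratic
Heegner for `N` with odd `d_K` and `p ∤ #𝓞_K^×`, `L(E^{d_K},1) ≠ 0`, `P = y_K` of the frame `(Dt, H, ι)`, `Wd` a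
globally minimal model of the twist; named facts Gross–Zagier, Kolyvagin, GZK, modularity, GZ86 I.(7.3) as
hypotheses. Proof: the exact identity `exists_shaAn_padicVal_eq_of_heegner_manin`
(`ord q + ord q_d + ord ∏c(E) + 2·ord #E^d(ℚ)_tors + 2·v_p(c) + v_p(u) = 2·ord[E(K):ℤP]`, `#Ш(E/K) ~ #Ш(E)·#Ш(E^d)`),
`#Ш_an(E^d) = q_d·#tors²/∏c(E^d)` (Wuthrich's bookkeeping), the two transports as equalities, and uniqueness of
the rational values of `#Ш_an`; then `linarith` with the joint inequality.
[cite: GrossZagier1986, Thm. I.(6.3) and (7.3)] [cite: Miller2011LMS, Def. 1.1 (arXiv:1010.2431 p. 3)]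
[cite: JetchevSkinnerWan2017, §7.4.1 (arXiv:1512.06894 p. 30)] -/
theorem indexUpperBoundLeAt_of_jointUpperBoundAt_manin
    (hGZ : ∀ (N : ℕ) [NeZero N] (W : WeierstrassCurve ℚ) (K : Type) [Field K] [NumberField K],
      gross_zagier N W K)
    (hKo : ∀ (N : ℕ) [NeZero N] (W : WeierstrassCurve ℚ) (K : Type) [Field K] [NumberField K],
      kolyvagin N W K)
    (hGZK : rank_eq_analyticRank_of_analyticRank_le_one) (hmod : hasEntireLFunction_rat)
    (hGZ73 : GrossZagier1986_thm_I_7_3)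
    (W : WeierstrassCurve ℚ) [W.IsElliptic] [W.IsGloballyMinimal] (p : ℕ) [Fact p.Prime]
    (N : ℕ) [NeZero N] (K : Type) [Field K] [NumberField K]
    (Dt : ModularParametrizationData W N) (H : HeegnerDatum N (NumberField.discr K)) (ι : K →+* ℂ)
    (P : (W.baseChange K).toAffine.Point) (Wd : WeierstrassCurve ℚ) [Wd.IsElliptic] [Wd.IsGloballyMinimal]
    (hr : W.analyticRank = 1) (hN : W.conductorNorm ℤ = N) (hpN : p ∣ N) (hK : IsImaginaryQuadratic K)
    (hodd : Odd (NumberField.discr K)) (hw : ¬ p ∣ Units.torsionOrder K)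
    (hHH : SatisfiesHeegnerHypothesis N K)
    (hLd : (W.quadraticTwist (NumberField.discr K : ℚ)).entireLFunction 1 ≠ 0)
    (hP : WeierstrassCurve.Affine.Point.map ι.toRatAlgHom P = heegnerPointComplex Dt H)
    (hC : ∃ C : VariableChange ℚ, C • W.quadraticTwist (NumberField.discr K : ℚ) = Wd)
    (hp2 : p ≠ 2) (hJ : JointUpperBoundAt W Wd p) :
    IndexUpperBoundLeAt W p K P (padicValNat p Dt.c.natAbs) := by
  have hpp : p.Prime := Fact.out
  obtain ⟨Cd, hWd⟩ := hC
  -- the twist's algebraic central value (Gross–Zagier I.(7.3))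
  obtain ⟨qd, hqd⟩ := SchneiderFree.exists_rat_twist_L_one_div_realPeriod_of_heegner W N K Dt H ι P
    (hGZ N W K) (hKo N W K) hGZK hmod hGZ73 hK hHH hP hr hLd Wd Cd hWd
  -- the Manin-robust bookkeeping identity (an EQUALITY)
  obtain ⟨-, -, hsha, q, hq, hval⟩ := SchneiderFree.exists_shaAn_padicVal_eq_of_heegner_manin W p N K
    Dt H ι P (hGZ N W K) (hKo N W K) hGZK hmod hK hHH hP hp2 hw hr hLd Wd Cd hWd qd hqd
  -- `#Ш_an(E^{d_K})` in rank zero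
  have hD0 : (NumberField.discr K : ℚ) ≠ 0 := by exact_mod_cast NumberField.discr_ne_zero K
  haveI : (W.quadraticTwist (NumberField.discr K : ℚ)).IsElliptic := W.isElliptic_quadraticTwist hD0
  have hLd1 : Wd.entireLFunction 1 ≠ 0 := by rw [← hWd, entireLFunction_smul]; exact hLd
  obtain ⟨-, hfin, -, hshaAnd⟩ := Wuthrich2014.shaAn_eq_of_L_one_div_eq hGZK Wd hLd1 hqd
  haveI := hfin
  have htdeq : Wd.torsionOrder = Nat.card Wd.toAffine.Point := Wd.torsionOrder_eq_natCard_of_finite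
  -- the two transports, as EQUALITIES (`p` odd, `p ∣ N` split in `K`)
  have hHN' : SatisfiesHeegnerHypothesis (W.conductorNorm ℤ) K := by rw [hN]; exact hHH
  have hHp : SatisfiesHeegnerHypothesis p K := SatisfiesHeegnerHypothesis.of_dvd hpN hHH
  have hpd : ¬ (p : ℤ) ∣ NumberField.discr K :=
    X11b.Three.not_dvd_discr_of_ncard_primesOver_eq_two hK.1 hp2 (hHH p hpp hpN)
  have htam := X2.padicValNat_tamagawaProduct_twist_of_heegner_of_odd W p hp2 K hK hodd hpd hHN' Cd hWd
  have hu := AdditivePotMult.padicValRat_u_eq_zero_of_twist_minimal_of_split W p K hK hHp Cd hWd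
  -- the joint upper half, with its rational values pinned to `q` and `qd·#tors²/∏c(E^d)`
  obtain ⟨q', qd', hq', hqd', hle⟩ := hJ
  have hqq : q' = q := by
    have : ((q' : ℂ)) = (q : ℂ) := by rw [← hq', hq]
    exact_mod_cast this
  subst hqq
  have hqd0 : qd ≠ 0 := by
    intro h0
    apply hLd1
    have hΩ : (Wd.realPeriodRat : ℂ) ≠ 0 := by exact_mod_cast Wd.realPeriodRat_pos_holds.ne'
    rw [h0, Rat.cast_zero, div_eq_zero_iff] at hqd
    exact hqd.resolve_right hΩ
  have htd0 : (Nat.card Wd.toAffine.Point : ℚ) ≠ 0 := by exact_mod_cast (Nat.card_pos).ne'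
  have hcd0 : (Wd.tamagawaProduct : ℚ) ≠ 0 := by exact_mod_cast Wd.tamagawaProduct_pos_holds.ne'
  have hqdd : qd' = qd * (Nat.card Wd.toAffine.Point : ℚ) ^ 2 / (Wd.tamagawaProduct : ℚ) := by
    have : ((qd' : ℂ)) = ((qd * (Nat.card Wd.toAffine.Point : ℚ) ^ 2 / (Wd.tamagawaProduct : ℚ) : ℚ) : ℂ) := by
      rw [← hqd', hshaAnd]
    exact_mod_cast this
  have hvd : padicValRat p qd' =
      padicValRat p qd + 2 * padicValNat p Wd.torsionOrder - padicValNat p Wd.tamagawaProduct := by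
    rw [hqdd, padicValRat.div (mul_ne_zero hqd0 (pow_ne_zero _ htd0)) hcd0,
      padicValRat.mul hqd0 (pow_ne_zero _ htd0), padicValRat.pow, padicValRat.of_nat, padicValRat.of_nat, htdeq]
    push_cast; ring
  rw [hvd] at hle
  unfold IndexUpperBoundLeAt
  have e2 : (padicValNat p (W.baseChange K).shaOrder : ℤ) =
      padicValNat p W.shaOrder + padicValNat p Wd.shaOrder := by exact_mod_cast hsha
  have e3 : (padicValNat p Wd.tamagawaProduct : ℤ) = padicValNat p W.tamagawaProduct := by exact_mod_cast htam
  have e1 : (padicValNat p (W.baseChange K).shaOrder : ℤ) + 2 * padicValNat p W.tamagawaProduct +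
      2 * padicValNat p Dt.c.natAbs ≤ 2 * padicValNat p (AddSubgroup.zmultiples P).index := by
    linarith
  exact_mod_cast e1

/-! ### §2 The two separate Euler-system halves ⟹ Ko's socket -/

/-- **`ord_p #Ш(E) ≤ ord_p #Ш_an(E)` and `ord_p #Ш(E^{d_K}) ≤ ord_p #Ш_an(E^{d_K})` ⟹ Ko's socket** on the frame
(the two SEPARATE upper halves give the joint one, `jointUpper_of_upper_of_upper`, then §1). Binders as in §1.
[cite: Miller2011LMS, Def. 1.1 (arXiv:1010.2431 p. 3)] [cite: GrossZagier1986, Thm. I.(6.3)] -/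
theorem indexUpperBoundLeAt_of_missingUpper_of_missingUpper
    (hGZ : ∀ (N : ℕ) [NeZero N] (W : WeierstrassCurve ℚ) (K : Type) [Field K] [NumberField K],
      gross_zagier N W K)
    (hKo : ∀ (N : ℕ) [NeZero N] (W : WeierstrassCurve ℚ) (K : Type) [Field K] [NumberField K],
      kolyvagin N W K)
    (hGZK : rank_eq_analyticRank_of_analyticRank_le_one) (hmod : hasEntireLFunction_rat)
    (hGZ73 : GrossZagier1986_thm_I_7_3)
    (W : WeierstrassCurve ℚ) [W.IsElliptic] [W.IsGloballyMinimal] (p : ℕ) [Fact p.Prime]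
    (N : ℕ) [NeZero N] (K : Type) [Field K] [NumberField K]
    (Dt : ModularParametrizationData W N) (H : HeegnerDatum N (NumberField.discr K)) (ι : K →+* ℂ)
    (P : (W.baseChange K).toAffine.Point) (Wd : WeierstrassCurve ℚ) [Wd.IsElliptic] [Wd.IsGloballyMinimal]
    (hr : W.analyticRank = 1) (hN : W.conductorNorm ℤ = N) (hpN : p ∣ N) (hK : IsImaginaryQuadratic K)
    (hodd : Odd (NumberField.discr K)) (hw : ¬ p ∣ Units.torsionOrder K)
    (hHH : SatisfiesHeegnerHypothesis N K)
    (hLd : (W.quadraticTwist (NumberField.discr K : ℚ)).entireLFunction 1 ≠ 0)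
    (hP : WeierstrassCurve.Affine.Point.map ι.toRatAlgHom P = heegnerPointComplex Dt H)
    (hC : ∃ C : VariableChange ℚ, C • W.quadraticTwist (NumberField.discr K : ℚ) = Wd)
    (hp2 : p ≠ 2) (hE : MissingUpperBoundAt W p) (hEd : MissingUpperBoundAt Wd p) :
    IndexUpperBoundLeAt W p K P (padicValNat p Dt.c.natAbs) :=
  indexUpperBoundLeAt_of_jointUpperBoundAt_manin hGZ hKo hGZK hmod hGZ73 W p N K Dt H ι P Wd hr hN hpN hK hodd
    hw hHH hLd hP hC hp2 (jointUpper_of_upper_of_upper hE hEd)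

/-- **`BSD_p(E) ∧ BSD_p(E^{d_K}) ⟹` Ko's socket** on the frame (each `BSD_p` gives its curve's upper half,
`missingPPartAt_of_bsdp` + `lower_and_upper_of_missingPPartAt`; `Ш` finite on both sides by GZK in analytic
rank `≤ 1`). Binders as in §1. [cite: Miller2011LMS, Def. 1.1 (arXiv:1010.2431 p. 3)] [cite: GrossZagier1986, Thm. I.(6.3)] -/
theorem indexUpperBoundLeAt_of_bsdp_of_bsdp
    (hGZ : ∀ (N : ℕ) [NeZero N] (W : WeierstrassCurve ℚ) (K : Type) [Field K] [NumberField K],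
      gross_zagier N W K)
    (hKo : ∀ (N : ℕ) [NeZero N] (W : WeierstrassCurve ℚ) (K : Type) [Field K] [NumberField K],
      kolyvagin N W K)
    (hGZK : rank_eq_analyticRank_of_analyticRank_le_one) (hmod : hasEntireLFunction_rat)
    (hGZ73 : GrossZagier1986_thm_I_7_3)
    (W : WeierstrassCurve ℚ) [W.IsElliptic] [W.IsGloballyMinimal] (p : ℕ) [Fact p.Prime]
    (N : ℕ) [NeZero N] (K : Type) [Field K] [NumberField K]
    (Dt : ModularParametrizationData W N) (H : HeegnerDatum N (NumberField.discr K)) (ι : K →+* ℂ)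
    (P : (W.baseChange K).toAffine.Point) (Wd : WeierstrassCurve ℚ) [Wd.IsElliptic] [Wd.IsGloballyMinimal]
    (hr : W.analyticRank = 1) (hN : W.conductorNorm ℤ = N) (hpN : p ∣ N) (hK : IsImaginaryQuadratic K)
    (hodd : Odd (NumberField.discr K)) (hw : ¬ p ∣ Units.torsionOrder K)
    (hHH : SatisfiesHeegnerHypothesis N K)
    (hLd : (W.quadraticTwist (NumberField.discr K : ℚ)).entireLFunction 1 ≠ 0)
    (hP : WeierstrassCurve.Affine.Point.map ι.toRatAlgHom P = heegnerPointComplex Dt H)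
    (hC : ∃ C : VariableChange ℚ, C • W.quadraticTwist (NumberField.discr K : ℚ) = Wd)
    (hp2 : p ≠ 2) (hbsd : BSDp W p) (hbsdd : BSDp Wd p) :
    IndexUpperBoundLeAt W p K P (padicValNat p Dt.c.natAbs) := by
  -- `Ш(E)` finite (analytic rank one) and `Ш(E^{d_K})` finite (analytic rank zero), by GZK
  obtain ⟨-, hfinW⟩ := hGZK W (by rw [hr])
  haveI : Finite W.sha := hfinW
  obtain ⟨Cd, hCd⟩ := hC
  have hD0 : (NumberField.discr K : ℚ) ≠ 0 := by exact_mod_cast NumberField.discr_ne_zero K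
  haveI : (W.quadraticTwist (NumberField.discr K : ℚ)).IsElliptic := W.isElliptic_quadraticTwist hD0
  have hLd1 : Wd.entireLFunction 1 ≠ 0 := by rw [← hCd, entireLFunction_smul]; exact hLd
  have hrd : Wd.analyticRank = 0 := analyticRank_eq_zero_of_entireLFunction_one_ne_zero Wd hLd1
  obtain ⟨-, hfinWd⟩ := hGZK Wd (by rw [hrd]; exact zero_le_one)
  haveI : Finite Wd.sha := hfinWd
  exact indexUpperBoundLeAt_of_missingUpper_of_missingUpper hGZ hKo hGZK hmod hGZ73 W p N K Dt H ι P Wd hr hN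
    hpN hK hodd hw hHH hLd hP ⟨Cd, hCd⟩ hp2
    (lower_and_upper_of_missingPPartAt W p (missingPPartAt_of_bsdp W p hbsd)).2
    (lower_and_upper_of_missingPPartAt Wd p (missingPPartAt_of_bsdp Wd p hbsdd)).2

/-! ### §3 Under crux Ko's verbatim binders: `BSD₃(E) ∧ BSD₃(E^{d_K})` ⟹ Ko's conclusion on the frame -/

/-- **Ko's conclusion on a frame ⟸ `BSD₃(E)` and `BSD₃(E^{d_K})`** (crux Ko's VERBATIM binders — onto wild
rank-one row at `3`, tower, odd `d_K ≠ −3`, `L(E^{d_K},1) ≠ 0`, `P = y_K` non-torsion — plus a globally minimal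
model `Wd` of the twist, and the named facts Gross–Zagier, Kolyvagin, GZK, modularity, GZ86 I.(7.3) as
hypotheses). `3 ∣ N` from `ClassO6` (additive at `3`); `3 ∤ #𝓞_K^×` since `3 ∣ N` splits in `K`. So on the
frames where Ko has no line of its own (≥ 2 carriers, method census NOGO-STRINGENT-SCALING-w3) it is a COROLLARY of
the W-ALL row for `E` and for `E^{d_K}`, and by door-c5's `jointUpperBoundAt_of_coStepL_manin` it is equivalent to
their joint Euler-system half. [cite: GrossZagier1986, Thm. I.(6.3) and (7.3)] [cite: Miller2011LMS, Def. 1.1] -/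
theorem wildKolyvaginUpperAtThree_frame_of_bsdp_of_bsdp
    (hGZ : ∀ (N : ℕ) [NeZero N] (W : WeierstrassCurve ℚ) (K : Type) [Field K] [NumberField K],
      gross_zagier N W K)
    (hKo : ∀ (N : ℕ) [NeZero N] (W : WeierstrassCurve ℚ) (K : Type) [Field K] [NumberField K],
      kolyvagin N W K)
    (hGZK : rank_eq_analyticRank_of_analyticRank_le_one) (hmod : hasEntireLFunction_rat)
    (hGZ73 : GrossZagier1986_thm_I_7_3)
    (W : WeierstrassCurve ℚ) [W.IsElliptic] [W.IsGloballyMinimal] (N : ℕ) [NeZero N] (K : Type) [Field K]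
    [NumberField K] (Dt : ModularParametrizationData W N) (H : HeegnerDatum N (NumberField.discr K))
    (ι : K →+* ℂ) (P : (W.baseChange K).toAffine.Point)
    (hO6 : ClassO6 W 3) (_hsurj : W.HasSurjectiveModNGaloisRep 3) (hr : W.analyticRank = 1)
    (hN : W.conductorNorm ℤ = N) (hK : IsImaginaryQuadratic K) (hHH : SatisfiesHeegnerHypothesis N K)
    (hLd : (W.quadraticTwist (NumberField.discr K : ℚ)).entireLFunction 1 ≠ 0)
    (hP : WeierstrassCurve.Affine.Point.map ι.toRatAlgHom P = heegnerPointComplex Dt H)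
    (_hnt : ¬ IsOfFinAddOrder P) (hodd : Odd (NumberField.discr K)) (_h3 : NumberField.discr K ≠ -3)
    (_htow : AdditiveThree.TowerSurjThree W)
    (Wd : WeierstrassCurve ℚ) [Wd.IsElliptic] [Wd.IsGloballyMinimal]
    (hC : ∃ C : VariableChange ℚ, C • W.quadraticTwist (NumberField.discr K : ℚ) = Wd)
    (hbsd : BSDp W 3) (hbsdd : BSDp Wd 3) :
    Upper.IndexUpperBoundLeAt W 3 K P (padicValNat 3 Dt.c.natAbs) := by
  haveI : Fact (3 : ℕ).Prime := ⟨by norm_num⟩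
  have h3N : 3 ∣ W.conductorNorm ℤ :=
    (W.dvd_conductorNorm_iff_not_hasGoodReductionAtPrime 3).mpr (not_good_of_addv W 3 hO6.2.1)
  have h3N' : 3 ∣ N := hN ▸ h3N
  have hw : ¬ 3 ∣ Units.torsionOrder K :=
    (X11b.Three.not_dvd_discr_and_not_dvd_torsionOrder_of_heegner hK (hN ▸ hHH) (by decide) h3N).2
  exact indexUpperBoundLeAt_of_bsdp_of_bsdp hGZ hKo hGZK hmod hGZ73 W 3 N K Dt H ι P Wd hr hN h3N' hK hodd hw
    hHH hLd hP hC (by decide) hbsd hbsdd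

end Summit.BirchSwinnertonDyer.BirchSwinnertonDyer.Theorems.WildKolyvaginUpperAtThreeOfJointUpper

end
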